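import Summits.QuantumFields.BalabanUV.Beta.FP.NestedStepLawOneShotLetters
import Summits.QuantumFields.BalabanUV.Beta.FP.RelInvPeriodisedCombRows
import Summits.QuantumFields.BalabanUV.Beta.FP.TorusCombNestedBasis

/-!
# `BalabanUV.Beta.FP.NestedStepLawTorusInstance` — road «FP», binder row D1, ROUTE T (R-FP-51∕52∕53), (T-INST-j): **THE TORUS CALL** — p308750's one-shot-sliced
# composite step law from 2-jets (`NestedStepLawOneShotJets.secondVar_oneShot_nestedStepLaw_jets`: STATIC slices, MOVING generators, the two Faddeev–Popov
# 2-jets DISPLAYED — frame-agnostic: R-D1-g36-1 reads the literal's slices as static, leaf-02's F-d1leaf02g17-1 reads the first-order border table as MOVING the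
# generators ultralocally; this file prejudges neither) AT THE TORUS OBJECTS OF RECORD BY NAME, with every binder the tree already proves DISCHARGED:
# `c0 : Q₁₀·[D₂|D₁] = [D̄|0]` (gan24-leaf-05's MASTER identities p308208 ∕ p309586), `h1` ((INV), leaf-05 p310903), `hTW` from `|det(τ₁D₁)| = 1` and
# `|det(τ₂D̄)| = (stepScale·#B)^{|ρ₂|}` (leaf-06 p309832 on both boxes; LEMMA N), `hPW` from `|det(P·[D₂|D₁])| = 1` for the ONE-SHOT slice of record `P` = the
# BIG comb rows re-indexed `ρ₂ ⊕ ρ₁` (leaf-06 p312437, the owner's sub-row (iii-b)), and `b0 b1 b2` (leaf-02's `compWard_b*` p310022).  DISPLAYED = the (T-ID)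
# residual (TID-LETTER-SPEC v1.3 § E + F-d1leaf02g17-1): the jets `H₁ H₂ Q₁₁ Q₁₂ Q₂ₖ Gₖ`, the generator jets `W₁ W₂` ∕ `D̄₁ D̄₂`, the second-order Ward ∕ covariance
# TABLE IDENTITIES `a* c1 c2 d*` in MOVING shapes, `h2` (leaf-05 `RelInvPeriodisedCoarse`), the `rfl`-namings — and, in the CONCLUSION, the Faddeev–Popov defect
# `2·secondVar(P·W-jets) − 2·secondVar(nested FP jets)` (zero in the static frame, a per-site sum in the forest frame — p311088; fate in `hSDF`: `UltralocalDefect`).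

THE TORUS OBJECTS (fine box `fine Lc M′` over the coarse box `M′`, `Lc ∣ M′_i`; root offsets `toSite r` (fine), `toSite r′` (coarse), `r r′ ∈ box (d+1) Lc`; step `j`):
`ν := ↥(pbox (fine Lc M′)) × Fin (d+1)`, `μ := ↥(pbox M′) × Fin (d+1)` (presented on the fine box by `(p̄, κ) ↦ (coarsePt p̄, inr κ)`), `ρ₁ := Res (toSite r) Lc (fine Lc M′)`,
`ρ₂ := Res (toSite r′) Lc M′`; `H₀ Q₁₀ := perF (fine Lc M′) (bhKStepAt d (toSite r) Lc j)` on `(ν,ν)`∕`(μ,ν)`, `τ₁ τ₂` the comb rows on the two boxes, `D₁ := tgrad↾`,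
`D₂ := tgradBlock↾`, `D̄ := (stepScale·#B)•tgrad M′↾`, `P :=` the comb rows of the BIG blocking `(Lc•toSite r′ + toSite r, Lc², fine Lc M′)` re-indexed by leaf-06's
`resBigEquiv` — all by DEFINING EQUATIONS (`hH₀ … hP`, instantiate with `rfl`), so the conclusion reads exactly as p308750's.

HONEST DEPENDENCY (page 1, mandatory): continuum YM on T⁴ ⇐ BetaPertH ∧ nine spine estimates (0/9 proved); BetaPertH ⇐ (D1) ∧ (D4) ∧ CAP+tail;
G-an2-4 gates asym, D1 and NE2/3/4.  HONEST FRAMING (cell contract, verbatim): «discharging `BetaPertH` makes Bałaban's UV stability UNCONDITIONAL —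
a real constructive-QFT result; it is NOT the continuum limit and NOT the Clay problem.»  ABSOLUTE RULE (cell charter, verbatim): «No internally-minted
statement may enter as a cited fact. Every hypothesis is either kernel-proved in this package or a verbatim quotation of a PUBLISHED theorem with page
reference. The manuscript(s) under audit are NOT citable for their own disputed steps — they are the thing under adjudication; programme-internal
(2001/route/tribunal) claims are never citable.»  [folklore] composition BY NAME; no `def`, no `def … : Prop`, nothing cited, 0 sorry; 0∕4 row-D1 binders:
NOT (T-ID) complete, NOT SDF, NOT D1, NOT BetaPertH, NOT continuum, NOT Clay.  Road «FP» OWNER, b2b-balaban-beta-d1-p3 gen 17, 2026-08-22.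
-/

noncomputable section

namespace Summit.QuantumFields.BalabanUV.Beta.FP.NestedStepLawTorusInstance

open Matrix Finset
open Literature.Probability.LatticeModels (Torus.proj)
open Literature.MathematicalPhysics.QuantumFieldTheory.Balaban1983to89
open Literature.MathematicalPhysics.QuantumFieldTheory.Balaban1983to89.Beta
open Literature.MathematicalPhysics.QuantumFieldTheory.Balaban1983to89.Beta.Composition (kkt)
open Literature.MathematicalPhysics.QuantumFieldTheory.Balaban1983to89.Beta.CompositionSingular (effForm flucCov minOp minOpL)
open Literature.MathematicalPhysics.QuantumFieldTheory.LatticeForm (quo)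
open B5Prop11Plancherel (fine)
open B6Lemma24Torus (pbox mem_pbox)
open AffineAveraging (Site box toSite)
open OneStepResolventKernel (Fib)
open Summit.QuantumFields.BalabanUV.Beta.BorderedHessian (bhKStepAt stepScale stepScale_ne_zero)
open Summit.QuantumFields.BalabanUV.Beta.D1BFx.LogDetSecondVariation (secondVar)
open Summit.QuantumFields.BalabanUV.Beta.FP.KernelPeriodisationFib (Idx perF)
open Summit.QuantumFields.BalabanUV.Beta.FP.TorusGaugeCovariance (tgrad tgrad_inr perF_bhKStepAt_mul_tgrad_of_not_root)
open Summit.QuantumFields.BalabanUV.Beta.FP.TorusGaugeCovarianceCoarse (coarsePt coarsePt_coe proj_coarsePt tgradBlock tgradBlock_inr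
  perF_bhKStepAt_coarsePt_mul_tgradBlock)
open Summit.QuantumFields.BalabanUV.Beta.FP.TorusCombForest (rootOf)
open Summit.QuantumFields.BalabanUV.Beta.FP.TorusCombRows (Res combRowsT abs_det_combRowsT_mul_tgrad_eq_one_of_box ne_rootOf_iff_proj_ne)
open Summit.QuantumFields.BalabanUV.Beta.FP.RelInvPeriodisedCombRows (torus_isUnit_det_kkt_combRows)
open Summit.QuantumFields.BalabanUV.Beta.FP.TorusCombNestedBasis (resBigEquiv abs_det_bigCombRows_mul_W0_eq_one)
open Summit.QuantumFields.BalabanUV.Beta.FP.NestedStepLawOneShotJets (secondVar_oneShot_nestedStepLaw_jets)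
open Summit.QuantumFields.BalabanUV.Beta.FP.NestedStepLawOneShotLetters (det_ne_zero_of_abs_det det_nestedSlice_mul_gauge_ne_zero)
open Summit.QuantumFields.BalabanUV.Beta.FP.CompositeWardLetters (compWard_b0 compWard_b1 compWard_b2)
open Summit.QuantumFields.BalabanUV.Beta.GAN24.FineReadoutCauchyFrame (toSite_mem_range)
open Summit.QuantumFields.BalabanUV.Beta.GAN24.CombesThomasFibre (eq_zsmul_quo_of_proj_eq_zero)

variable {d : ℕ}

/-! ## §1 Slot algebra: products read on the field slots -/

section Slots

variable (M : Fin (d + 1) → ℕ) [∀ μ, NeZero (M μ)]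

omit [∀ μ, NeZero (M μ)] in
/-- [folklore] **A PRODUCT AGAINST A MATRIX VANISHING ON THE MULTIPLIER ROWS IS READ ON THE FIELD SLOTS**: `A↾(f, field) · X↾(field, g) = (A·X)↾(f, g)`. -/
theorem submatrix_field_mul {α α' β β' : Type*} (A : Matrix α (Idx M (Fib d)) ℝ) (X : Matrix (Idx M (Fib d)) β ℝ)
    (hX : ∀ (y : ↥(pbox M)) (κ : Fin (d + 1)) (c : β), X (y, Sum.inr κ) c = 0) (f : α' → α) (g : β' → β) :
    A.submatrix f (fun b : ↥(pbox M) × Fin (d + 1) => ((b.1, Sum.inl b.2) : Idx M (Fib d)))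
        * X.submatrix (fun b : ↥(pbox M) × Fin (d + 1) => ((b.1, Sum.inl b.2) : Idx M (Fib d))) g
      = (A * X).submatrix f g := by
  ext i j
  simp only [Matrix.mul_apply, Matrix.submatrix_apply]
  rw [Fintype.sum_prod_type, Fintype.sum_prod_type]
  refine Finset.sum_congr rfl fun y _ => ?_
  rw [Fintype.sum_sum_type]
  simp only [hX, mul_zero, Finset.sum_const_zero, add_zero]

omit [∀ μ, NeZero (M μ)] in
/-- [folklore] `(A·X)↾(id, g) = A · X↾(id, g)`. -/
theorem submatrix_id_mul {α β β' : Type*} (A : Matrix α (Idx M (Fib d)) ℝ) (X : Matrix (Idx M (Fib d)) β ℝ) (g : β' → β) :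
    (A * X).submatrix id g = A * X.submatrix id g := by
  ext i j
  rfl

end Slots

/-! ## §2 The torus letters that the tree already proves -/

section Letters

variable (M' : Fin (d + 1) → ℕ) [∀ μ, NeZero (M' μ)] {Lc : ℕ} [NeZero Lc] {r r' : Fin (d + 1) → ℕ}

omit [∀ μ, NeZero (M' μ)] [NeZero Lc] in
/-- [folklore] the fine box sizes are multiples of the blocking. -/
theorem dvd_fine (i : Fin (d + 1)) : Lc ∣ fine Lc M' i := ⟨M' i, rfl⟩

omit [∀ μ, NeZero (M' μ)] in
/-- [folklore] the coarse-site presentation `(p̄, κ) ↦ (coarsePt p̄, inr κ)` of the live multiplier slots is injective. -/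
theorem coarseSlot_injective :
    Function.Injective (fun a : ↥(pbox M') × Fin (d + 1) => ((coarsePt M' Lc a.1, Sum.inr a.2) : Idx (fine Lc M') (Fib d))) := by
  rintro ⟨p, κ⟩ ⟨p', κ'⟩ h
  simp only [Prod.mk.injEq, Sum.inr.injEq] at h
  obtain ⟨hp, hκ⟩ := h
  refine Prod.ext (Subtype.ext (funext fun i => ?_)) hκ
  have hc := congrArg (fun s : ↥(pbox (fine Lc M')) => (s : Fin (d + 1) → ℤ) i) hp
  simp only [coarsePt_coe, Pi.smul_apply, smul_eq_mul] at hc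
  exact mul_left_cancel₀ (by exact_mod_cast NeZero.ne Lc) hc

omit [∀ μ, NeZero (M' μ)] in
/-- [folklore] the coarse-site presentation hits exactly the multiplier slots at the coarse sites `proj Lc s = 0`. -/
theorem coarseSlot_range (s : ↥(pbox (fine Lc M'))) (m : Fin (d + 1)) :
    ((s, Sum.inr m) : Idx (fine Lc M') (Fib d)) ∈ Set.range (fun a : ↥(pbox M') × Fin (d + 1) => ((coarsePt M' Lc a.1, Sum.inr a.2) : Idx (fine Lc M') (Fib d)))
      ↔ Torus.proj Lc (s : Fin (d + 1) → ℤ) = 0 := by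
  constructor
  · rintro ⟨⟨p, κ⟩, h⟩
    have hs : coarsePt M' Lc p = s := congrArg Prod.fst h
    rw [← hs]; exact proj_coarsePt M' Lc p
  · intro hs
    have hLc : (0 : ℤ) < Lc := by exact_mod_cast Nat.pos_of_ne_zero (NeZero.ne Lc)
    have hq : (s : Fin (d + 1) → ℤ) = (Lc : ℤ) • quo Lc (s : Fin (d + 1) → ℤ) := eq_zsmul_quo_of_proj_eq_zero hs
    have ht : quo Lc (s : Fin (d + 1) → ℤ) ∈ pbox M' := by
      rw [mem_pbox]; intro i
      have hsi := (mem_pbox.mp s.2) i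
      have e : (s : Fin (d + 1) → ℤ) i = (Lc : ℤ) * quo Lc (s : Fin (d + 1) → ℤ) i := by
        conv_lhs => rw [hq]
        rfl
      rw [e] at hsi
      have hfi : ((fine Lc M' i : ℕ) : ℤ) = (Lc : ℤ) * (M' i : ℤ) := by push_cast [fine]; ring
      refine ⟨(mul_nonneg_iff_of_pos_left hLc).mp hsi.1, lt_of_mul_lt_mul_left ?_ hLc.le⟩
      rw [← hfi]; exact hsi.2
    refine ⟨(⟨quo Lc (s : Fin (d + 1) → ℤ), ht⟩, m), ?_⟩
    simp only [Prod.mk.injEq, and_true]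
    exact Subtype.ext (by rw [coarsePt_coe, ← hq])

set_option synthInstance.maxSize 1024 in
/-- [folklore] **`h1` AT THE TORUS** ((INV), leaf-05 p310903 at the coarse-site presentation): the comb-sliced fine system is non-degenerate. -/
theorem torus_h1 (hr : r ∈ box (d + 1) Lc) (j : ℕ) :
    (kkt ((perF (fine Lc M') (bhKStepAt d (toSite r) Lc j)).submatrix
            (fun b : ↥(pbox (fine Lc M')) × Fin (d + 1) => ((b.1, Sum.inl b.2) : Idx (fine Lc M') (Fib d)))
            (fun b : ↥(pbox (fine Lc M')) × Fin (d + 1) => ((b.1, Sum.inl b.2) : Idx (fine Lc M') (Fib d))))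
      (fromRows
        ((perF (fine Lc M') (bhKStepAt d (toSite r) Lc j)).submatrix
            (fun a : ↥(pbox M') × Fin (d + 1) => ((coarsePt M' Lc a.1, Sum.inr a.2) : Idx (fine Lc M') (Fib d)))
            (fun b : ↥(pbox (fine Lc M')) × Fin (d + 1) => ((b.1, Sum.inl b.2) : Idx (fine Lc M') (Fib d))))
        ((combRowsT (toSite r) Lc (fine Lc M')).submatrix id
            (fun b : ↥(pbox (fine Lc M')) × Fin (d + 1) => ((b.1, Sum.inl b.2) : Idx (fine Lc M') (Fib d)))))).det ≠ 0 :=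
  (torus_isUnit_det_kkt_combRows (fine Lc M') hr (dvd_fine M') j _ (coarseSlot_injective M') (fun a => ⟨a.2, rfl⟩)
    (coarseSlot_range M')).ne_zero

/-- [folklore] **`h₁ : Q₁₀·D₁ = 0` AT THE TORUS** ((C1), gan24-leaf-05 p308208): the live multiplier rows kill the torus gradients of the non-root indicators. -/
theorem torus_cov₁ (hr : r ∈ box (d + 1) Lc) (j : ℕ) :
    (perF (fine Lc M') (bhKStepAt d (toSite r) Lc j)).submatrix
          (fun a : ↥(pbox M') × Fin (d + 1) => ((coarsePt M' Lc a.1, Sum.inr a.2) : Idx (fine Lc M') (Fib d)))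
          (fun b : ↥(pbox (fine Lc M')) × Fin (d + 1) => ((b.1, Sum.inl b.2) : Idx (fine Lc M') (Fib d)))
        * (tgrad (fine Lc M')).submatrix (fun b : ↥(pbox (fine Lc M')) × Fin (d + 1) => ((b.1, Sum.inl b.2) : Idx (fine Lc M') (Fib d)))
            (Subtype.val : Res (toSite r) Lc (fine Lc M') → ↥(pbox (fine Lc M'))) = 0 := by
  rw [submatrix_field_mul (fine Lc M') _ _ (tgrad_inr (fine Lc M'))]
  ext a x
  rw [Matrix.submatrix_apply, Matrix.mul_apply, Matrix.zero_apply]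
  have hLc : 0 < Lc := Nat.pos_of_ne_zero (NeZero.ne Lc)
  exact perF_bhKStepAt_mul_tgrad_of_not_root (fine Lc M') hr (dvd_fine M') j _ a.2
    ((ne_rootOf_iff_proj_ne hLc (toSite_mem_range hr) _).1 x.2)

/-- [folklore] **`h₂ : Q₁₀·D₂ = D̄` AT THE TORUS** (MASTER-COARSE, gan24-leaf-05 p309586): the live multiplier rows send the block-constant modes to
`(stepScale·#B)` times the coarse torus gradients. -/
theorem torus_cov₂ (hr : r ∈ box (d + 1) Lc) (j : ℕ) :
    (perF (fine Lc M') (bhKStepAt d (toSite r) Lc j)).submatrix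
          (fun a : ↥(pbox M') × Fin (d + 1) => ((coarsePt M' Lc a.1, Sum.inr a.2) : Idx (fine Lc M') (Fib d)))
          (fun b : ↥(pbox (fine Lc M')) × Fin (d + 1) => ((b.1, Sum.inl b.2) : Idx (fine Lc M') (Fib d)))
        * (tgradBlock M' Lc).submatrix (fun b : ↥(pbox (fine Lc M')) × Fin (d + 1) => ((b.1, Sum.inl b.2) : Idx (fine Lc M') (Fib d)))
            (Subtype.val : Res (toSite r') Lc M' → ↥(pbox M'))
      = Matrix.of fun (a : ↥(pbox M') × Fin (d + 1)) (t : Res (toSite r') Lc M') =>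
          stepScale d Lc j * (((box (d + 1) Lc).card : ℝ) * tgrad M' (a.1, Sum.inl a.2) t.1) := by
  rw [submatrix_field_mul (fine Lc M') _ _ (tgradBlock_inr M' Lc)]
  ext a t
  rw [Matrix.submatrix_apply, Matrix.mul_apply, Matrix.of_apply]
  exact perF_bhKStepAt_coarsePt_mul_tgradBlock M' hr j a.1 a.2 t.1

omit [∀ μ, NeZero (M' μ)] in
/-- [folklore] **`hc₁ : |det(τ₁·D₁)| = 1` AT THE TORUS** ((UNI), leaf-06 p309832): the fine comb rows against the residual torus gradients, read on the field slots. -/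
theorem torus_uni₁ (hr : r ∈ box (d + 1) Lc) :
    |((combRowsT (toSite r) Lc (fine Lc M')).submatrix id
          (fun b : ↥(pbox (fine Lc M')) × Fin (d + 1) => ((b.1, Sum.inl b.2) : Idx (fine Lc M') (Fib d)))
        * (tgrad (fine Lc M')).submatrix (fun b : ↥(pbox (fine Lc M')) × Fin (d + 1) => ((b.1, Sum.inl b.2) : Idx (fine Lc M') (Fib d)))
            (Subtype.val : Res (toSite r) Lc (fine Lc M') → ↥(pbox (fine Lc M')))).det| = 1 := by
  rw [submatrix_field_mul (fine Lc M') _ _ (tgrad_inr (fine Lc M')), submatrix_id_mul]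
  exact abs_det_combRowsT_mul_tgrad_eq_one_of_box hr (Nat.pos_of_ne_zero (NeZero.ne Lc)) (dvd_fine M')

omit [∀ μ, NeZero (M' μ)] in
/-- [folklore] **`hc₂ : |det(τ₂·D̄)| = (stepScale·#B)^{|ρ₂|}` AT THE TORUS** ((UNI) on the coarse box, leaf-06 p309832, scaled by the displayed MASTER-COARSE factor). -/
theorem torus_uni₂ (hr' : r' ∈ box (d + 1) Lc) (hM' : ∀ i, Lc ∣ M' i) (j : ℕ) :
    |((combRowsT (toSite r') Lc M').submatrix id (fun b : ↥(pbox M') × Fin (d + 1) => ((b.1, Sum.inl b.2) : Idx M' (Fib d)))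
        * Matrix.of fun (a : ↥(pbox M') × Fin (d + 1)) (t : Res (toSite r') Lc M') =>
            stepScale d Lc j * (((box (d + 1) Lc).card : ℝ) * tgrad M' (a.1, Sum.inl a.2) t.1)).det|
      = |stepScale d Lc j * ((box (d + 1) Lc).card : ℝ)| ^ Fintype.card (Res (toSite r') Lc M') := by
  have hD : (Matrix.of fun (a : ↥(pbox M') × Fin (d + 1)) (t : Res (toSite r') Lc M') =>
        stepScale d Lc j * (((box (d + 1) Lc).card : ℝ) * tgrad M' (a.1, Sum.inl a.2) t.1))
      = ((tgrad M').submatrix (fun b : ↥(pbox M') × Fin (d + 1) => ((b.1, Sum.inl b.2) : Idx M' (Fib d))) (Subtype.val : Res (toSite r') Lc M' → ↥(pbox M'))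
            : Matrix (↥(pbox M') × Fin (d + 1)) (Res (toSite r') Lc M') ℝ)
          * Matrix.diagonal (fun _ : Res (toSite r') Lc M' => stepScale d Lc j * ((box (d + 1) Lc).card : ℝ)) := by
    ext a t
    rw [Matrix.mul_diagonal, Matrix.of_apply, Matrix.submatrix_apply]
    ring
  rw [hD, ← Matrix.mul_assoc, submatrix_field_mul M' _ _ (tgrad_inr M'), submatrix_id_mul, Matrix.det_mul, Matrix.det_diagonal, abs_mul,
    Finset.prod_const, Finset.card_univ, abs_pow]
  have h1 : |(combRowsT (toSite r') Lc M' * (tgrad M').submatrix id Subtype.val).det| = 1 :=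
    abs_det_combRowsT_mul_tgrad_eq_one_of_box hr' (Nat.pos_of_ne_zero (NeZero.ne Lc)) hM'
  calc |(combRowsT (toSite r') Lc M' * (tgrad M').submatrix id Subtype.val).det|
          * |stepScale d Lc j * ((box (d + 1) Lc).card : ℝ)| ^ Fintype.card (Res (toSite r') Lc M')
        = 1 * |stepScale d Lc j * ((box (d + 1) Lc).card : ℝ)| ^ Fintype.card (Res (toSite r') Lc M') := by
          congr 1
    _ = |stepScale d Lc j * ((box (d + 1) Lc).card : ℝ)| ^ Fintype.card (Res (toSite r') Lc M') := one_mul _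

omit [∀ μ, NeZero (M' μ)] in
/-- [folklore] the (UNI) constant of the coarse box is non-zero. -/
theorem torus_uni₂_ne_zero (hr' : r' ∈ box (d + 1) Lc) (j : ℕ) :
    |stepScale d Lc j * ((box (d + 1) Lc).card : ℝ)| ^ Fintype.card (Res (toSite r') Lc M') ≠ 0 := by
  refine pow_ne_zero _ (abs_ne_zero.mpr (mul_ne_zero (stepScale_ne_zero j) ?_))
  exact_mod_cast (Finset.card_pos.mpr ⟨r', hr'⟩).ne'

/-- [folklore] **`hcP : |det(P·[D₂|D₁])| = 1` AT THE TORUS** (sub-row (iii-b), leaf-06 `TorusCombNestedBasis` p312437): the BIG comb rows re-indexed `ρ₂ ⊕ ρ₁` against the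
descending ⊕ residual generators, read on the field slots. -/
theorem torus_uniP (hr : r ∈ box (d + 1) Lc) (hr' : r' ∈ box (d + 1) Lc) (hM' : ∀ i, Lc ∣ M' i) :
    |(((combRowsT ((Lc : ℤ) • toSite r' + toSite r) (Lc * Lc) (fine Lc M')).submatrix
          (resBigEquiv Lc Lc (toSite r) (toSite r') M' (Nat.pos_of_ne_zero (NeZero.ne Lc)) (toSite_mem_range hr)
            (Nat.pos_of_ne_zero (NeZero.ne Lc)) (toSite_mem_range hr')).symm
          (fun b : ↥(pbox (fine Lc M')) × Fin (d + 1) => ((b.1, Sum.inl b.2) : Idx (fine Lc M') (Fib d))))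
        * fromCols
            ((tgradBlock M' Lc).submatrix (fun b : ↥(pbox (fine Lc M')) × Fin (d + 1) => ((b.1, Sum.inl b.2) : Idx (fine Lc M') (Fib d)))
              (Subtype.val : Res (toSite r') Lc M' → ↥(pbox M')))
            ((tgrad (fine Lc M')).submatrix (fun b : ↥(pbox (fine Lc M')) × Fin (d + 1) => ((b.1, Sum.inl b.2) : Idx (fine Lc M') (Fib d)))
              (Subtype.val : Res (toSite r) Lc (fine Lc M') → ↥(pbox (fine Lc M'))))).det| = 1 := by
  have hW : fromCols
        ((tgradBlock M' Lc).submatrix (fun b : ↥(pbox (fine Lc M')) × Fin (d + 1) => ((b.1, Sum.inl b.2) : Idx (fine Lc M') (Fib d)))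
          (Subtype.val : Res (toSite r') Lc M' → ↥(pbox M')))
        ((tgrad (fine Lc M')).submatrix (fun b : ↥(pbox (fine Lc M')) × Fin (d + 1) => ((b.1, Sum.inl b.2) : Idx (fine Lc M') (Fib d)))
          (Subtype.val : Res (toSite r) Lc (fine Lc M') → ↥(pbox (fine Lc M'))))
      = (fromCols ((tgradBlock M' Lc).submatrix id (Subtype.val : Res (toSite r') Lc M' → ↥(pbox M')))
            ((tgrad (fine Lc M')).submatrix id (Subtype.val : Res (toSite r) Lc (fine Lc M') → ↥(pbox (fine Lc M'))))).submatrix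
          (fun b : ↥(pbox (fine Lc M')) × Fin (d + 1) => ((b.1, Sum.inl b.2) : Idx (fine Lc M') (Fib d))) id := by
    ext b c; rcases c with t | s <;> rfl
  have hX : ∀ (y : ↥(pbox (fine Lc M'))) (κ : Fin (d + 1)) (c : Res (toSite r') Lc M' ⊕ Res (toSite r) Lc (fine Lc M')),
      fromCols ((tgradBlock M' Lc).submatrix id (Subtype.val : Res (toSite r') Lc M' → ↥(pbox M')))
        ((tgrad (fine Lc M')).submatrix id (Subtype.val : Res (toSite r) Lc (fine Lc M') → ↥(pbox (fine Lc M')))) (y, Sum.inr κ) c = 0 := by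
    rintro y κ (t | s)
    · exact tgradBlock_inr M' Lc y κ t.1
    · exact tgrad_inr (fine Lc M') y κ s.1
  have key := (congrArg (fun X => (combRowsT ((Lc : ℤ) • toSite r' + toSite r) (Lc * Lc) (fine Lc M')).submatrix
      (resBigEquiv Lc Lc (toSite r) (toSite r') M' (Nat.pos_of_ne_zero (NeZero.ne Lc)) (toSite_mem_range hr)
        (Nat.pos_of_ne_zero (NeZero.ne Lc)) (toSite_mem_range hr')).symm
      (fun b : ↥(pbox (fine Lc M')) × Fin (d + 1) => ((b.1, Sum.inl b.2) : Idx (fine Lc M') (Fib d))) * X) hW).trans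
    (submatrix_field_mul (fine Lc M') _ _ hX _ id)
  have key2 : (combRowsT ((Lc : ℤ) • toSite r' + toSite r) (Lc * Lc) (fine Lc M')).submatrix
        (resBigEquiv Lc Lc (toSite r) (toSite r') M' (Nat.pos_of_ne_zero (NeZero.ne Lc)) (toSite_mem_range hr)
          (Nat.pos_of_ne_zero (NeZero.ne Lc)) (toSite_mem_range hr')).symm id
      * fromCols ((tgradBlock M' Lc).submatrix id fun t : Res (toSite r') Lc M' => t.1)
          ((tgrad (fine Lc M')).submatrix id fun s : Res (toSite r) Lc (fine Lc M') => s.1)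
      = ((combRowsT ((Lc : ℤ) • toSite r' + toSite r) (Lc * Lc) (fine Lc M'))
          * fromCols ((tgradBlock M' Lc).submatrix id (Subtype.val : Res (toSite r') Lc M' → ↥(pbox M')))
              ((tgrad (fine Lc M')).submatrix id (Subtype.val : Res (toSite r) Lc (fine Lc M') → ↥(pbox (fine Lc M'))))).submatrix
          (resBigEquiv Lc Lc (toSite r) (toSite r') M' (Nat.pos_of_ne_zero (NeZero.ne Lc)) (toSite_mem_range hr)
            (Nat.pos_of_ne_zero (NeZero.ne Lc)) (toSite_mem_range hr')).symm id := by
    ext i j; rfl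
  refine (congrArg (fun X : Matrix (Res (toSite r') Lc M' ⊕ Res (toSite r) Lc (fine Lc M')) (Res (toSite r') Lc M' ⊕ Res (toSite r) Lc (fine Lc M')) ℝ
      => |X.det|) (key.trans key2.symm)).trans ?_
  exact abs_det_bigCombRows_mul_W0_eq_one (Nat.pos_of_ne_zero (NeZero.ne Lc)) (toSite_mem_range hr) (Nat.pos_of_ne_zero (NeZero.ne Lc))
    (toSite_mem_range hr') hM'

end Letters

/-! ## §3 THE TORUS CALL (frame-agnostic: static slices, displayed generator jets, displayed Faddeev–Popov defect) -/

section Call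

variable (M' : Fin (d + 1) → ℕ) [∀ μ, NeZero (M' μ)] {Lc : ℕ} [NeZero Lc] {r r' : Fin (d + 1) → ℕ}

set_option synthInstance.maxSize 1024 in
/-- [folklore] **THE ONE-SHOT-SLICED COMPOSITE STEP LAW ON THE TORUS AT THE OBJECTS OF RECORD, FRAME-AGNOSTIC** (p308750 with `H₀ Q₁₀ τ₁ τ₂ D₁ D₂ D̄ P`
the torus objects by defining equations, `W₀ := [D₂|D₁]`; `h1 c0 hTW hPW b*` discharged by §2; displayed: jets, generator jets `W₁ W₂ D̄₁ D̄₂`, the TABLE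
IDENTITIES `c1 c2 d* a*` in moving shapes, namings, `h2`; the Faddeev–Popov defect is displayed in the conclusion). -/
theorem secondVar_oneShot_nestedStepLaw_torus (hr : r ∈ box (d + 1) Lc) (hr' : r' ∈ box (d + 1) Lc) (hM' : ∀ i, Lc ∣ M' i) (j : ℕ)
    {κ : Type*} [Fintype κ] [DecidableEq κ]
    -- the torus objects of record, by defining equations
    {H₀ : Matrix (↥(pbox (fine Lc M')) × Fin (d + 1)) (↥(pbox (fine Lc M')) × Fin (d + 1)) ℝ}
    {Q₁₀ : Matrix (↥(pbox M') × Fin (d + 1)) (↥(pbox (fine Lc M')) × Fin (d + 1)) ℝ}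
    {τ₁ : Matrix (Res (toSite r) Lc (fine Lc M')) (↥(pbox (fine Lc M')) × Fin (d + 1)) ℝ}
    {τ₂ : Matrix (Res (toSite r') Lc M') (↥(pbox M') × Fin (d + 1)) ℝ}
    {D₁ : Matrix (↥(pbox (fine Lc M')) × Fin (d + 1)) (Res (toSite r) Lc (fine Lc M')) ℝ}
    {D₂ : Matrix (↥(pbox (fine Lc M')) × Fin (d + 1)) (Res (toSite r') Lc M') ℝ}
    {Dbar : Matrix (↥(pbox M') × Fin (d + 1)) (Res (toSite r') Lc M') ℝ}
    {P : Matrix (Res (toSite r') Lc M' ⊕ Res (toSite r) Lc (fine Lc M')) (↥(pbox (fine Lc M')) × Fin (d + 1)) ℝ}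
    (hH₀ : H₀ = (perF (fine Lc M') (bhKStepAt d (toSite r) Lc j)).submatrix
        (fun b : ↥(pbox (fine Lc M')) × Fin (d + 1) => ((b.1, Sum.inl b.2) : Idx (fine Lc M') (Fib d)))
        (fun b : ↥(pbox (fine Lc M')) × Fin (d + 1) => ((b.1, Sum.inl b.2) : Idx (fine Lc M') (Fib d))))
    (hQ₁₀ : Q₁₀ = (perF (fine Lc M') (bhKStepAt d (toSite r) Lc j)).submatrix
        (fun a : ↥(pbox M') × Fin (d + 1) => ((coarsePt M' Lc a.1, Sum.inr a.2) : Idx (fine Lc M') (Fib d)))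
        (fun b : ↥(pbox (fine Lc M')) × Fin (d + 1) => ((b.1, Sum.inl b.2) : Idx (fine Lc M') (Fib d))))
    (hτ₁ : τ₁ = (combRowsT (toSite r) Lc (fine Lc M')).submatrix id
        (fun b : ↥(pbox (fine Lc M')) × Fin (d + 1) => ((b.1, Sum.inl b.2) : Idx (fine Lc M') (Fib d))))
    (hτ₂ : τ₂ = (combRowsT (toSite r') Lc M').submatrix id (fun b : ↥(pbox M') × Fin (d + 1) => ((b.1, Sum.inl b.2) : Idx M' (Fib d))))
    (hD₁ : D₁ = (tgrad (fine Lc M')).submatrix (fun b : ↥(pbox (fine Lc M')) × Fin (d + 1) => ((b.1, Sum.inl b.2) : Idx (fine Lc M') (Fib d)))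
        (Subtype.val : Res (toSite r) Lc (fine Lc M') → ↥(pbox (fine Lc M'))))
    (hD₂ : D₂ = (tgradBlock M' Lc).submatrix (fun b : ↥(pbox (fine Lc M')) × Fin (d + 1) => ((b.1, Sum.inl b.2) : Idx (fine Lc M') (Fib d)))
        (Subtype.val : Res (toSite r') Lc M' → ↥(pbox M')))
    (hDbar : Dbar = Matrix.of fun (a : ↥(pbox M') × Fin (d + 1)) (t : Res (toSite r') Lc M') =>
        stepScale d Lc j * (((box (d + 1) Lc).card : ℝ) * tgrad M' (a.1, Sum.inl a.2) t.1))
    (hP : P = (combRowsT ((Lc : ℤ) • toSite r' + toSite r) (Lc * Lc) (fine Lc M')).submatrix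
        (resBigEquiv Lc Lc (toSite r) (toSite r') M' (Nat.pos_of_ne_zero (NeZero.ne Lc)) (toSite_mem_range hr)
          (Nat.pos_of_ne_zero (NeZero.ne Lc)) (toSite_mem_range hr')).symm
        (fun b : ↥(pbox (fine Lc M')) × Fin (d + 1) => ((b.1, Sum.inl b.2) : Idx (fine Lc M') (Fib d))))
    -- the displayed jets: form, averaging (both levels), block covariance, generators (fine and coarse), Ward witnesses
    (H₁ H₂ : Matrix (↥(pbox (fine Lc M')) × Fin (d + 1)) (↥(pbox (fine Lc M')) × Fin (d + 1)) ℝ)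
    (Q₁₁ Q₁₂ : Matrix (↥(pbox M') × Fin (d + 1)) (↥(pbox (fine Lc M')) × Fin (d + 1)) ℝ) (Q₂₀ Q₂₁ Q₂₂ : Matrix κ (↥(pbox M') × Fin (d + 1)) ℝ)
    (G₀ G₁ G₂ : Matrix (↥(pbox M') × Fin (d + 1)) (↥(pbox M') × Fin (d + 1)) ℝ)
    (W₁ W₂ : Matrix (↥(pbox (fine Lc M')) × Fin (d + 1)) (Res (toSite r') Lc M' ⊕ Res (toSite r) Lc (fine Lc M')) ℝ)
    (Db₁ Db₂ : Matrix (↥(pbox M') × Fin (d + 1)) (Res (toSite r') Lc M') ℝ)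
    (Y₀ Y₁ Y₂ Y'₀ Y'₁ Y'₂ : Matrix κ (Res (toSite r') Lc M' ⊕ Res (toSite r) Lc (fine Lc M')) ℝ)
    {𝔎₀ 𝔎₁ 𝔎₂ : Matrix (↥(pbox (fine Lc M')) × Fin (d + 1)) (↥(pbox (fine Lc M')) × Fin (d + 1)) ℝ}
    {𝔔₀ 𝔔₁ 𝔔₂ : Matrix κ (↥(pbox (fine Lc M')) × Fin (d + 1)) ℝ}
    (h𝔎₀ : H₀ + Q₁₀ᵀ * G₀ * Q₁₀ = 𝔎₀) (h𝔎₁ : H₁ + (Q₁₁ᵀ * G₀ * Q₁₀ + Q₁₀ᵀ * G₁ * Q₁₀ + Q₁₀ᵀ * G₀ * Q₁₁) = 𝔎₁)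
    (h𝔎₂ : H₂ + ((Q₁₂ᵀ * G₀ * Q₁₀ + Q₁₁ᵀ * G₁ * Q₁₀ + Q₁₁ᵀ * G₀ * Q₁₁) + (Q₁₁ᵀ * G₁ * Q₁₀ + Q₁₀ᵀ * G₂ * Q₁₀ + Q₁₀ᵀ * G₁ * Q₁₁)
            + (Q₁₁ᵀ * G₀ * Q₁₁ + Q₁₀ᵀ * G₁ * Q₁₁ + Q₁₀ᵀ * G₀ * Q₁₂)) = 𝔎₂)
    (h𝔔₀ : Q₂₀ * Q₁₀ = 𝔔₀) (h𝔔₁ : Q₂₁ * Q₁₀ + Q₂₀ * Q₁₁ = 𝔔₁) (h𝔔₂ : Q₂₂ * Q₁₀ + Q₂₁ * Q₁₁ + (Q₂₁ * Q₁₁ + Q₂₀ * Q₁₂) = 𝔔₂)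
    -- the second-order composite Ward TABLE IDENTITIES (p308750's moving shapes, `W₀ := [D₂ | D₁]`) and their transposes
    (a0 : 𝔎₀ * fromCols D₂ D₁ = 𝔔₀ᵀ * Y₀) (a1 : 𝔎₁ * fromCols D₂ D₁ + 𝔎₀ * W₁ = 𝔔₁ᵀ * Y₀ + 𝔔₀ᵀ * Y₁)
    (a2 : 𝔎₂ * fromCols D₂ D₁ + (2 : ℝ) • (𝔎₁ * W₁) + 𝔎₀ * W₂ = 𝔔₂ᵀ * Y₀ + (2 : ℝ) • (𝔔₁ᵀ * Y₁) + 𝔔₀ᵀ * Y₂)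
    (a0t : 𝔎₀ᵀ * fromCols D₂ D₁ = 𝔔₀ᵀ * Y'₀) (a1t : 𝔎₁ᵀ * fromCols D₂ D₁ + 𝔎₀ᵀ * W₁ = 𝔔₁ᵀ * Y'₀ + 𝔔₀ᵀ * Y'₁)
    (a2t : 𝔎₂ᵀ * fromCols D₂ D₁ + (2 : ℝ) • (𝔎₁ᵀ * W₁) + 𝔎₀ᵀ * W₂ = 𝔔₂ᵀ * Y'₀ + (2 : ℝ) • (𝔔₁ᵀ * Y'₁) + 𝔔₀ᵀ * Y'₂)
    -- the insertion-table covariance TABLE IDENTITIES (orders 1, 2; leaf-02's jet shapes) and the coarse covariance identities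
    (c1 : Q₁₁ * fromCols D₂ D₁ + Q₁₀ * W₁ = fromCols Db₁ 0) (c2 : Q₁₂ * fromCols D₂ D₁ + (2 : ℝ) • (Q₁₁ * W₁) + Q₁₀ * W₂ = fromCols Db₂ 0)
    (d0 : Q₂₀ * Dbar = 0) (d1 : Q₂₁ * Dbar + Q₂₀ * Db₁ = 0) (d2 : Q₂₂ * Dbar + (2 : ℝ) • (Q₂₁ * Db₁) + Q₂₀ * Db₂ = 0)
    -- block namings and the coarse non-degeneracy
    {Γ : Matrix (↥(pbox (fine Lc M')) × Fin (d + 1)) (↥(pbox (fine Lc M')) × Fin (d + 1)) ℝ}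
    {I : Matrix (↥(pbox (fine Lc M')) × Fin (d + 1)) ((↥(pbox M') × Fin (d + 1)) ⊕ Res (toSite r) Lc (fine Lc M')) ℝ}
    {L : Matrix ((↥(pbox M') × Fin (d + 1)) ⊕ Res (toSite r) Lc (fine Lc M')) (↥(pbox (fine Lc M')) × Fin (d + 1)) ℝ}
    {S : Matrix ((↥(pbox M') × Fin (d + 1)) ⊕ Res (toSite r) Lc (fine Lc M')) ((↥(pbox M') × Fin (d + 1)) ⊕ Res (toSite r) Lc (fine Lc M')) ℝ}
    {B : Matrix ((↥(pbox M') × Fin (d + 1)) ⊕ Res (toSite r) Lc (fine Lc M')) (↥(pbox (fine Lc M')) × Fin (d + 1)) ℝ}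
    (hΓ : flucCov H₀ (fromRows Q₁₀ τ₁) = Γ) (hI : minOp H₀ (fromRows Q₁₀ τ₁) = I) (hL : minOpL H₀ (fromRows Q₁₀ τ₁) = L) (hS : effForm H₀ (fromRows Q₁₀ τ₁) = S)
    (hB : fromRows Q₁₁ (0 : Matrix (Res (toSite r) Lc (fine Lc M')) (↥(pbox (fine Lc M')) × Fin (d + 1)) ℝ) = B)
    (h2 : (kkt (S.toBlocks₁₁ + G₀) (fromRows Q₂₀ τ₂)).det ≠ 0) :
    secondVar (kkt 𝔎₀ (fromRows 𝔔₀ P))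
        (kkt 𝔎₁ (fromRows 𝔔₁ (0 : Matrix (Res (toSite r') Lc M' ⊕ Res (toSite r) Lc (fine Lc M')) (↥(pbox (fine Lc M')) × Fin (d + 1)) ℝ)))
        (kkt 𝔎₂ (fromRows 𝔔₂ (0 : Matrix (Res (toSite r') Lc M' ⊕ Res (toSite r) Lc (fine Lc M')) (↥(pbox (fine Lc M')) × Fin (d + 1)) ℝ)))
      = secondVar (kkt H₀ (fromRows Q₁₀ τ₁)) (kkt H₁ B)
            (kkt H₂ (fromRows Q₁₂ (0 : Matrix (Res (toSite r) Lc (fine Lc M')) (↥(pbox (fine Lc M')) × Fin (d + 1)) ℝ)))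
        + secondVar
            (kkt (S.toBlocks₁₁ + G₀) (fromRows Q₂₀ τ₂))
            (kkt (((L * H₁ - S * B) * I - L * Bᵀ * S).toBlocks₁₁ + G₁) (fromRows Q₂₁ (0 : Matrix (Res (toSite r') Lc M') (↥(pbox M') × Fin (d + 1)) ℝ)))
            (kkt ((((-((L * H₁ - S * B) * Γ + L * Bᵀ * L) * H₁ + L * H₂
                      - (((L * H₁ - S * B) * I - L * Bᵀ * S) * B
                          + S * fromRows Q₁₂ (0 : Matrix (Res (toSite r) Lc (fine Lc M')) (↥(pbox (fine Lc M')) × Fin (d + 1)) ℝ))) * I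
                    + (L * H₁ - S * B) * (-((Γ * H₁ + I * B) * I - Γ * Bᵀ * S)))
                  - ((-((L * H₁ - S * B) * Γ + L * Bᵀ * L) * Bᵀ
                        + L * (fromRows Q₁₂ (0 : Matrix (Res (toSite r) Lc (fine Lc M')) (↥(pbox (fine Lc M')) × Fin (d + 1)) ℝ))ᵀ) * S
                      + L * Bᵀ * ((L * H₁ - S * B) * I - L * Bᵀ * S))).toBlocks₁₁ + G₂)
              (fromRows Q₂₂ (0 : Matrix (Res (toSite r') Lc M') (↥(pbox M') × Fin (d + 1)) ℝ)))
        + (2 * secondVar (P * fromCols D₂ D₁) (P * W₁) (P * W₂)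
          - 2 * secondVar (fromRows (τ₂ * Q₁₀) τ₁ * fromCols D₂ D₁)
              (fromRows (τ₂ * Q₁₁) (0 : Matrix (Res (toSite r) Lc (fine Lc M')) (↥(pbox (fine Lc M')) × Fin (d + 1)) ℝ) * fromCols D₂ D₁
                + fromRows (τ₂ * Q₁₀) τ₁ * W₁)
              (fromRows (τ₂ * Q₁₂) (0 : Matrix (Res (toSite r) Lc (fine Lc M')) (↥(pbox (fine Lc M')) × Fin (d + 1)) ℝ) * fromCols D₂ D₁
                + fromRows (τ₂ * Q₁₁) (0 : Matrix (Res (toSite r) Lc (fine Lc M')) (↥(pbox (fine Lc M')) × Fin (d + 1)) ℝ) * W₁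
                + (fromRows (τ₂ * Q₁₁) (0 : Matrix (Res (toSite r) Lc (fine Lc M')) (↥(pbox (fine Lc M')) × Fin (d + 1)) ℝ) * W₁
                  + fromRows (τ₂ * Q₁₀) τ₁ * W₂))) := by
  -- the torus binders
  have h1 : (kkt H₀ (fromRows Q₁₀ τ₁)).det ≠ 0 := by rw [hH₀, hQ₁₀, hτ₁]; exact torus_h1 M' hr j
  have h₁ : Q₁₀ * D₁ = 0 := by rw [hQ₁₀, hD₁]; exact torus_cov₁ M' hr j
  have h₂ : Q₁₀ * D₂ = Dbar := by rw [hQ₁₀, hD₂, hDbar]; exact torus_cov₂ M' hr j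
  have hc₁ : |(τ₁ * D₁).det| = 1 := by rw [hτ₁, hD₁]; exact torus_uni₁ M' hr
  have hc₂ : |(τ₂ * Dbar).det| = |stepScale d Lc j * ((box (d + 1) Lc).card : ℝ)| ^ Fintype.card (Res (toSite r') Lc M') := by
    rw [hτ₂, hDbar]; exact torus_uni₂ M' hr' hM' j
  have hcP : |(P * fromCols D₂ D₁).det| = 1 := by rw [hP, hD₂, hD₁]; exact torus_uniP M' hr hr' hM'
  -- order-0 covariance in `[D̄ | 0]` form, the composite `𝔔`-letters (leaf-02), the two Faddeev–Popov binders
  have c0 : Q₁₀ * fromCols D₂ D₁ = fromCols Dbar (0 : Matrix (↥(pbox M') × Fin (d + 1)) (Res (toSite r) Lc (fine Lc M')) ℝ) := by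
    rw [mul_fromCols, h₂, h₁]
  have b0 := compWard_b0 Q₁₀ Q₂₀ (fromCols D₂ D₁) Dbar c0 d0 h𝔔₀
  have b1 := compWard_b1 Q₁₀ Q₁₁ Q₂₀ Q₂₁ (fromCols D₂ D₁) W₁ Dbar Db₁ c0 c1 d1 h𝔔₀ h𝔔₁
  have b2 := compWard_b2 Q₁₀ Q₁₁ Q₁₂ Q₂₀ Q₂₁ Q₂₂ (fromCols D₂ D₁) W₁ W₂ Dbar Db₁ Db₂ c0 c1 c2 d2 h𝔔₀ h𝔔₁ h𝔔₂
  have hPW : (P * fromCols D₂ D₁).det ≠ 0 := det_ne_zero_of_abs_det hcP one_ne_zero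
  have hTW : (fromRows (τ₂ * Q₁₀) τ₁ * fromCols D₂ D₁).det ≠ 0 :=
    det_nestedSlice_mul_gauge_ne_zero τ₁ τ₂ Q₁₀ D₁ D₂ Dbar h₁ h₂ hc₁ hc₂ one_ne_zero (torus_uni₂_ne_zero M' hr' j)
  exact secondVar_oneShot_nestedStepLaw_jets H₀ H₁ H₂ Q₁₀ Q₁₁ Q₁₂ Q₂₀ Q₂₁ Q₂₂ G₀ G₁ G₂ τ₁ τ₂ P (fromCols D₂ D₁) W₁ W₂ Y₀ Y₁ Y₂ Y'₀ Y'₁ Y'₂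
    h𝔎₀ h𝔎₁ h𝔎₂ h𝔔₀ h𝔔₁ h𝔔₂ a0 a1 a2 a0t a1t a2t b0 b1 b2 hPW hTW hΓ hI hL hS hB h1 h2

end Call

end Summit.QuantumFields.BalabanUV.Beta.FP.NestedStepLawTorusInstance

end
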